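import Literature.NumberTheory.LFunctions.YoshidaWindowSpaces
import Literature.NumberTheory.LFunctions.WeilPolarTrigBasis
import HarnessLib

/-!
# The Connes–Consani trigonometric basis lies in Yoshida's `K(a)` (dictionary CC 2023 §2.1.3 ↔ Yoshida 1992 §2–3)

Sources: H. Yoshida, *On Hermitian forms attached to zeta functions*, Adv. Stud. Pure Math. **21** (1992),
p. 282 and p. 287 (the space `K(a)`: restrictions to `[−a, a]` of smooth `2a`-periodic functions, extended by
`0`), p. 289 (the exponential basis `χ_n`) [Yoshida1992HermitianForms]; A. Connes, C. Consani, *Spectral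
triples and ζ-cycles*, Enseign. Math. **69** (2023) 93–148, §2.1.3 p. 107 (the real orthonormal basis `ξ_n` of
`L²([−L/2, L/2])`: `ξ_0 = L^{-1/2}`, `ξ_n = (−1)^n (2/L)^{1/2} cos(2πnx/L)` for `n > 0`,
`ξ_n = (−1)^n (2/L)^{1/2} sin(2πnx/L)` for `n < 0`, zero outside the window) [ConnesConsani2023].

What is proved (no named fact): for `L > 0` every `ξ_n` (the tree's `SemilocalTrigBasis.xi L n`, viewed as a
complex-valued function) belongs to Yoshida's `K(L/2)` (`xi_mem_K`: it is the restriction to `[−L/2, L/2]` of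
the smooth `L`-periodic function `SemilocalTrigBasis.xiCore L n`), hence so does every finite linear
combination — the finite trigonometric sections `E_N` on which the tree's certificate formats and the
Connes–Consani(-Moscovici) computations work (`sum_smul_xi_mem_K`). This is the dictionary sentence
"`E_N(t) ⊂ K(t)`" between the two printed coordinate systems (Connes–Consani's real basis `ξ_n`, period
`L = 2a`; Yoshida's complex basis `χ_n`, p. 289); Yoshida's Theorem 1 (`Yoshida1992.theorem1`) therefore
speaks about all of them at `a = (log 2)/2`.
-/

noncomputable section

open Set
open scoped Real ContDiff

namespace Literature.NumberTheory.LFunctions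

namespace SemilocalTrigBasis

/-- The un-truncated basis function `ξ_n` (constant / cosine / sine) is smooth.
[cite: ConnesConsani2023, §2.1.3 (basis), p. 107] -/
theorem contDiff_xiCore (L : ℝ) (n : ℤ) : ContDiff ℝ ∞ (xiCore L n) := by
  unfold xiCore
  split_ifs <;> fun_prop

/-- The un-truncated basis function `ξ_n` has period `L` (`L ≠ 0`).
[cite: ConnesConsani2023, §2.1.3 (basis), p. 107] -/
theorem xiCore_periodic {L : ℝ} (hL : L ≠ 0) (n : ℤ) : Function.Periodic (xiCore L n) L := by
  intro x
  unfold xiCore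
  have harg : 2 * π * n * (x + L) / L = 2 * π * n * x / L + n * (2 * π) := by
    rw [mul_add, add_div, mul_div_cancel_right₀ _ hL]
    ring
  split_ifs
  · rfl
  · rw [harg, Real.cos_add_int_mul_two_pi]
  · rw [harg, Real.sin_add_int_mul_two_pi]

end SemilocalTrigBasis

namespace Yoshida1992

/-- **`ξ_n ∈ K(L/2)`**: the Connes–Consani basis function `ξ_n` of the window `[−L/2, L/2]` (extended by `0`),
viewed as a complex-valued function, lies in Yoshida's space `K(a)` with `a = L/2` — it is the restriction of
the smooth `L = 2a`-periodic function `xiCore L n` (`L > 0`).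
[cite: Yoshida1992HermitianForms, §0 p. 282 and §2 p. 287 (definition of K(a)); ConnesConsani2023 §2.1.3 p. 107] -/
theorem xi_mem_K {L : ℝ} (hL : 0 < L) (n : ℤ) :
    (fun x ↦ ((SemilocalTrigBasis.xi L n x : ℝ) : ℂ)) ∈ K (L / 2) := by
  refine ⟨fun x ↦ ((SemilocalTrigBasis.xiCore L n x : ℝ) : ℂ),
    Complex.ofRealCLM.contDiff.comp (SemilocalTrigBasis.contDiff_xiCore L n), ?_, fun x hx ↦ ?_,
    fun x hx ↦ ?_⟩
  · intro x
    have h := SemilocalTrigBasis.xiCore_periodic hL.ne' n x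
    simp only [show 2 * (L / 2) = L by ring, h]
  · have hx' : x ∈ Icc (-(L / 2)) (L / 2) := by
      rw [mem_Icc, ← abs_le]; exact hx
    simp only [SemilocalTrigBasis.xi, indicator_of_mem hx']
  · have hx' : x ∉ Icc (-(L / 2)) (L / 2) := by
      rw [mem_Icc, ← abs_le, not_le]; exact hx
    simp only [SemilocalTrigBasis.xi, indicator_of_notMem hx', Complex.ofReal_zero]

/-- Every finite (complex) linear combination of the `ξ_n` — i.e. every element of a finite trigonometric
section `E_N` of the window — lies in `K(L/2)` (`L > 0`).
[cite: Yoshida1992HermitianForms, §0 p. 282 (K(a) is a vector space containing the window's trigonometric system, §3 p. 289); ConnesConsani2023 §2.1.3 p. 107] -/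
theorem sum_smul_xi_mem_K {L : ℝ} (hL : 0 < L) (s : Finset ℤ) (c : ℤ → ℂ) :
    (∑ n ∈ s, c n • fun x ↦ ((SemilocalTrigBasis.xi L n x : ℝ) : ℂ)) ∈ K (L / 2) :=
  Submodule.sum_mem _ fun n _ ↦ Submodule.smul_mem _ _ (xi_mem_K hL n)

end Yoshida1992

end Literature.NumberTheory.LFunctions
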